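import Summits.QuantumFields.YangMills.Theorems.UnitScaleTiltProp7MassivePropagatorAgmon
import HarnessLib

/-!
# Route `UnitScaleTilt`, crux K1 «MinimiserStabilityRegPr» (stmt-QuantumFields-19200), EX row `hGF[Lift]` (curved member) — **LOD LINE, PEN (L5″) (RB2-tail):
# THE TAIL OF A MASSIVE PROPAGATOR OFF A PLATEAU** — the number `τ` of the (RB2) knit ✓`Prop7TopMeanComparisonOnPropagator.norm_lift_topMean_sub_le_of_tail` (px5 p755451):
if `A u = f` for the massive system (`A = Δ^η_{U₀} + a·T(ι(Q''·))`, the `hAu` of ✓`Prop7MassivePropagatorAgmon.agmon_rows_exp` VERBATIM), the Agmon phase `φ` vanishes on `supp f`, and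
`φ ≥ R` wherever the fattened cut-off `χ̃` is not `1` (`|1 − χ̃| ≤ 1`), then **`‖toL2S((1 − χ̃)·u)‖ ≤ e^{−R}·8·C_P²·‖toL2S f‖`**, `C_P² = max 2 (16c₀(L^{K−n})³∕(a c₁))`, inside the
Agmon window of p749343 (`3η⁻²(e^θ − 1)² + a(25κ∕8)(e^{θ′} − 1)² ≤ δ₁²`, `C_P·δ₁ ≤ 1∕10`).  Pointwise domination `‖(1 − χ̃(x))u(x)‖ ≤ e^{−R}·e^{φ(x)}‖u(x)‖` + (A-L²) of ✓`agmon_rows_exp`.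

Cell `ym3-torus` (HUMAN RULING D-0037, YM ladder rung R3 — NOT d = 4, NOT infinite volume, NOT a mass gap, NOT Clay).  Width seat `ym3-torus-px5` gen 11; ★p1 g24 LOCATE-L6-ASSEMBLY
§1 Step I.2 (L5″), road (α).  THEOREMS ONLY (0 `def`, 0 `sorry`); `--supports stmt-QuantumFields-19200 --as helper`, count-neutral.  HONEST LABEL (★★OWNER RULING №33 (6)): curved γ-row
supplier line (LOD localisation), pen (L5″); displayed data: the phase∕plateau geometry (`hφ`, `hφc`, `hφf`, `hR`) and the Agmon window; nothing of (3.49), Thm 3.1∕3.3, `h349`, `hGF`,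
EX ∕ 19200 is proved here.

References: T. Bałaban, CMP **99** (1985) 389–434 [Balaban1985BackgroundPropagators] (Thm 3.3 p.399, (3.105) p.414, (3.24) p.394); J.-M. Combes, L. Thomas, CMP **34** (1973) 251–270
[CombesThomas1973] (Lemma 1 p.255).
-/

set_option autoImplicit false

noncomputable section

open scoped BigOperators Matrix.Norms.L2Operator InnerProductSpace ComplexConjugate

namespace Summit.QuantumFields.YangMills.Theorems.Prop7MassivePropagatorTail

open Literature.MathematicalPhysics.QuantumFieldTheory.Balaban1983to89
open T4Continuum BlockAveraging
open BlockAveraging (Idx)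
open B7Prop1Explicit (disp)
open B5Eq118OneStroke (iterBlockOf)
open B10Eq27TorusAxialLog (holT transl)
open B7TransferAnalyticMean (meanCLM)
open B11Eq103H1Complex (SiteL2K)
open Summit.QuantumFields.YangMills.Theorems.Prop8Chart (emlIterU)
open Literature.MathematicalPhysics.QuantumFieldTheory.Balaban1983to89.T3ContinuumYM3Torus
open T3SectALandauChart (eta bgUnits)
open T3PrintedRegularMinimiser (RegPr)
open T3PrintedRegularOrbits (sites_eq)
open T3LevelShift (siteShift)
open Summit.QuantumFields.YangMills.Theorems.Prop7SectET3Transport (periodsT3)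
open Summit.QuantumFields.YangMills.Theorems.Prop7SectET3HilbertLetters (W₂ toL2S DL2 covLapSite)
open Summit.QuantumFields.YangMills.Theorems.Prop7MassivePropagatorAgmonLetters (norm_toL2S_smul_le)
open Summit.QuantumFields.YangMills.Theorems.Prop7MassivePropagatorAgmon (agmon_rows_exp)

variable (F : T3Family) {n K : ℕ} (h : n ≤ K) {c₀ c₁ : ℝ} [Fact (0 < c₀)] [Fact (0 < c₁)] {ε₀ : ℝ} (hε₀ : 0 < ε₀) (hε7 : 10 ^ 7 * (F.L : ℝ) ^ 3 * ε₀ ≤ 1)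
  (U₀ : GaugeField (F.P K) 0 (Matrix.specialUnitaryGroup (Fin 2) ℂ)) (hreg : RegPr F n K ε₀ U₀)
  (Q'' : SiteL2K ℂ 3 (periodsT3 F K) c₀ W₂ →ₗ[ℂ] (Site (F.P K) (K - n) → Matrix (Fin 2) (Fin 2) ℂ))
  (hseq : ∀ lam : Site (F.P K) 0 → Matrix (Fin 2) (Fin 2) ℂ, ∃ ns : (j : ℕ) → Site (F.P K) j → Matrix (Fin 2) (Fin 2) ℂ, ns 0 = lam ∧
        (∀ (j : ℕ) (y : Site (F.P K) (j + 1)), ns (j + 1) y = ns j (emb y) - meanCLM (Idx (F.P K)) (Matrix (Fin 2) (Fin 2) ℂ) fun i : Idx (F.P K) =>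
          ns j (emb y) - ((holT (emlIterU j (bgUnits F K U₀)) (emb y) (stairWord i.2.1 (off i.1)) : (Matrix (Fin 2) (Fin 2) ℂ)ˣ) : Matrix (Fin 2) (Fin 2) ℂ) *
            ns j (transl (emb y) (disp (stairWord i.2.1 (off i.1)))) * (((holT (emlIterU j (bgUnits F K U₀)) (emb y) (stairWord i.2.1 (off i.1)))⁻¹ : (Matrix (Fin 2) (Fin 2) ℂ)ˣ) : Matrix (Fin 2) (Fin 2) ℂ)) ∧
        ns (K - n) = Q'' (toL2S F K c₀ lam))
  (ι : (Site (F.P K) (K - n) → Matrix (Fin 2) (Fin 2) ℂ) →ₗ[ℂ] SiteL2K ℂ 3 (periodsT3 F n) c₁ W₂)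
  (hι : ∀ c, ι c = toL2S F n c₁ (fun z => c (siteShift (sites_eq F n K h) z)))
  (T : SiteL2K ℂ 3 (periodsT3 F n) c₁ W₂ →ₗ[ℂ] SiteL2K ℂ 3 (periodsT3 F K) c₀ W₂)
  (hT : ∀ (l : SiteL2K ℂ 3 (periodsT3 F K) c₀ W₂) (f : SiteL2K ℂ 3 (periodsT3 F n) c₁ W₂), ⟪ι (Q'' l), f⟫_ℂ = ⟪l, T f⟫_ℂ)
  {a : ℝ} (ha : 0 < a)

/-- **POINTWISE DOMINATION OFF THE PLATEAU**: if `|1 − χ̃ x| ≤ 1` everywhere and `R ≤ φ x` wherever `χ̃ x ≠ 1`, then `|(1 − χ̃ x)·e^{−φ x}| ≤ e^{−R}` for every `x`. [folklore]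
[cite: CombesThomas1973, Lemma 1 p.255] -/
theorem abs_one_sub_mul_exp_neg_le (χt φ : Site (F.P K) 0 → ℝ) {R : ℝ} (hχt : ∀ x, |1 - χt x| ≤ 1) (hR : ∀ x, χt x ≠ 1 → R ≤ φ x)
    (x : Site (F.P K) 0) : |(1 - χt x) * Real.exp (-φ x)| ≤ Real.exp (-R) := by
  by_cases hx : χt x = 1
  · rw [hx, sub_self, zero_mul, abs_zero]; exact (Real.exp_pos _).le
  · rw [abs_mul, Real.abs_exp]
    calc |1 - χt x| * Real.exp (-φ x) ≤ 1 * Real.exp (-R) :=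
          mul_le_mul (hχt x) (Real.exp_le_exp.mpr (by linarith [hR x hx])) (Real.exp_pos _).le zero_le_one
      _ = Real.exp (-R) := one_mul _

include hε₀ hε7 hreg hseq hι hT ha in
/-- ★★★ **THE TAIL NUMBER `τ` OF (RB2)**: in the Agmon window of ✓`agmon_rows_exp` (phase `φ` with bond steps `θ`, in-block oscillation `θ′` about `φc`,
`3η⁻²(e^θ − 1)² + a(25κ∕8)(e^{θ′} − 1)² ≤ δ₁²`, `C_P·δ₁ ≤ 1∕10`), for the massive solution `A u = f` (`hAu` VERBATIM), a phase vanishing on `supp f` (`f x ≠ 0 ⟹ φ x = 0`) and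
`≥ R` off the plateau of `χ̃` (`χ̃ x ≠ 1 ⟹ R ≤ φ x`, `|1 − χ̃| ≤ 1`): `‖toL2S((1 − χ̃)·u)‖ ≤ e^{−R}·(8·C_P²)·‖toL2S f‖`, `C_P = √(max 2 (16c₀(L^{K−n})³∕(a c₁)))`.
[cite: Balaban1985BackgroundPropagators, Thm 3.3 p.399, (3.105) p.414; CombesThomas1973, Lemma 1 p.255] -/
theorem norm_tail_le_of_massive_eq (φ : Site (F.P K) 0 → ℝ) (φc : Site (F.P K) (K - n) → ℝ) {θ θ' : ℝ} (hθ' : 0 ≤ θ')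
    (hφ : ∀ b : PBond (F.P K) 0, |φ b.tgt - φ b.src| ≤ θ) (hφc : ∀ x : Site (F.P K) 0, |φ x - φc (iterBlockOf (K - n) x)| ≤ θ')
    {δ₁ : ℝ} (hδ₁ : 0 ≤ δ₁)
    (hδ : 3 * ((eta F n K)⁻¹) ^ 2 * (Real.exp θ - 1) ^ 2 + a * ((25 / 8) * (c₁ * ((((F.P K).L : ℝ) ^ (F.P K).d) ^ (K - n))⁻¹ / c₀)) * (Real.exp θ' - 1) ^ 2 ≤ δ₁ ^ 2)
    (hwin : Real.sqrt (max 2 (16 * c₀ * ((F.L : ℝ) ^ (K - n)) ^ 3 / (a * c₁))) * δ₁ ≤ 1 / 10)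
    (χt : Site (F.P K) 0 → ℝ) {R : ℝ} (hχt : ∀ x, |1 - χt x| ≤ 1) (hR : ∀ x, χt x ≠ 1 → R ≤ φ x)
    (u f : Site (F.P K) 0 → Matrix (Fin 2) (Fin 2) ℂ) (hφf : ∀ x, f x ≠ 0 → φ x = 0)
    (hAu : covLapSite F n K c₀ U₀ (toL2S F K c₀ u) + (a : ℂ) • T (ι (Q'' (toL2S F K c₀ u))) = toL2S F K c₀ f) :
    ‖toL2S F K c₀ (fun x => (1 - χt x) • u x)‖ ≤ Real.exp (-R) * (8 * Real.sqrt (max 2 (16 * c₀ * ((F.L : ℝ) ^ (K - n)) ^ 3 / (a * c₁))) ^ 2) * ‖toL2S F K c₀ f‖ := by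
  have hAL2 := (agmon_rows_exp F h hε₀ hε7 U₀ hreg Q'' hseq ι hι T hT ha φ φc hθ' hφ hφc hδ₁ hδ hwin u f hAu).1
  -- `e^φ·f = f`
  have hff : (fun x => Real.exp (φ x) • f x) = f := by
    funext x
    by_cases hx : f x = 0
    · rw [hx, smul_zero]
    · rw [hφf x hx, Real.exp_zero, one_smul]
  rw [hff] at hAL2
  -- `(1 − χ̃)·u = ((1 − χ̃)e^{−φ})·(e^φ·u)`
  have hfact : (fun x => (1 - χt x) • u x) = fun x => ((1 - χt x) * Real.exp (-φ x)) • (Real.exp (φ x) • u x) := by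
    funext x
    rw [smul_smul, mul_assoc, ← Real.exp_add, neg_add_cancel, Real.exp_zero, mul_one]
  rw [hfact]
  have hdom := norm_toL2S_smul_le F (c₀ := c₀) (fun x => (1 - χt x) * Real.exp (-φ x)) (Real.exp_pos (-R)).le
    (abs_one_sub_mul_exp_neg_le F χt φ hχt hR) (fun x => Real.exp (φ x) • u x)
  calc _ ≤ Real.exp (-R) * ‖toL2S F K c₀ (fun x => Real.exp (φ x) • u x)‖ := hdom
    _ ≤ Real.exp (-R) * (8 * Real.sqrt (max 2 (16 * c₀ * ((F.L : ℝ) ^ (K - n)) ^ 3 / (a * c₁))) ^ 2 * ‖toL2S F K c₀ f‖) := mul_le_mul_of_nonneg_left hAL2 (Real.exp_pos _).le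
    _ = _ := by ring

include hε₀ hε7 hreg hseq hι hT ha in
/-- ★★★ **THE TAIL OF A TWICE-PROPAGATED VECTOR** (the `u`-tail `τ_u` of ✓`Prop7GramDifferenceNearRow.norm_gram_apply_sub_le_near`, `u = G(G w)`): in the same Agmon window, if
`A v = w` and `A u = v` (both `hA·` VERBATIM), the phase vanishes on `supp w` and is `≥ R` off the plateau of `χ̃` (`|1 − χ̃| ≤ 1`), then
`‖toL2S((1 − χ̃)·u)‖ ≤ e^{−R}·(8·C_P²)²·‖toL2S w‖` ((A-L²) of ✓`agmon_rows_exp` twice: `‖e^φu‖ ≤ 8C_P²‖e^φv‖ ≤ (8C_P²)²‖e^φw‖ = (8C_P²)²‖w‖`).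
[cite: Balaban1985BackgroundPropagators, Thm 3.3 p.399, (3.105) p.414; CombesThomas1973, Lemma 1 p.255] -/
theorem norm_tail_le_of_massive_eq_twice (φ : Site (F.P K) 0 → ℝ) (φc : Site (F.P K) (K - n) → ℝ) {θ θ' : ℝ} (hθ' : 0 ≤ θ')
    (hφ : ∀ b : PBond (F.P K) 0, |φ b.tgt - φ b.src| ≤ θ) (hφc : ∀ x : Site (F.P K) 0, |φ x - φc (iterBlockOf (K - n) x)| ≤ θ')
    {δ₁ : ℝ} (hδ₁ : 0 ≤ δ₁)
    (hδ : 3 * ((eta F n K)⁻¹) ^ 2 * (Real.exp θ - 1) ^ 2 + a * ((25 / 8) * (c₁ * ((((F.P K).L : ℝ) ^ (F.P K).d) ^ (K - n))⁻¹ / c₀)) * (Real.exp θ' - 1) ^ 2 ≤ δ₁ ^ 2)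
    (hwin : Real.sqrt (max 2 (16 * c₀ * ((F.L : ℝ) ^ (K - n)) ^ 3 / (a * c₁))) * δ₁ ≤ 1 / 10)
    (χt : Site (F.P K) 0 → ℝ) {R : ℝ} (hχt : ∀ x, |1 - χt x| ≤ 1) (hR : ∀ x, χt x ≠ 1 → R ≤ φ x)
    (u v w : Site (F.P K) 0 → Matrix (Fin 2) (Fin 2) ℂ) (hφw : ∀ x, w x ≠ 0 → φ x = 0)
    (hAv : covLapSite F n K c₀ U₀ (toL2S F K c₀ v) + (a : ℂ) • T (ι (Q'' (toL2S F K c₀ v))) = toL2S F K c₀ w)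
    (hAu : covLapSite F n K c₀ U₀ (toL2S F K c₀ u) + (a : ℂ) • T (ι (Q'' (toL2S F K c₀ u))) = toL2S F K c₀ v) :
    ‖toL2S F K c₀ (fun x => (1 - χt x) • u x)‖ ≤ Real.exp (-R) * (8 * Real.sqrt (max 2 (16 * c₀ * ((F.L : ℝ) ^ (K - n)) ^ 3 / (a * c₁))) ^ 2) ^ 2 * ‖toL2S F K c₀ w‖ := by
  have hAL2v := (agmon_rows_exp F h hε₀ hε7 U₀ hreg Q'' hseq ι hι T hT ha φ φc hθ' hφ hφc hδ₁ hδ hwin v w hAv).1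
  have hAL2u := (agmon_rows_exp F h hε₀ hε7 U₀ hreg Q'' hseq ι hι T hT ha φ φc hθ' hφ hφc hδ₁ hδ hwin u v hAu).1
  have hww : (fun x => Real.exp (φ x) • w x) = w := by
    funext x
    by_cases hx : w x = 0
    · rw [hx, smul_zero]
    · rw [hφw x hx, Real.exp_zero, one_smul]
  rw [hww] at hAL2v
  have hfact : (fun x => (1 - χt x) • u x) = fun x => ((1 - χt x) * Real.exp (-φ x)) • (Real.exp (φ x) • u x) := by
    funext x
    rw [smul_smul, mul_assoc, ← Real.exp_add, neg_add_cancel, Real.exp_zero, mul_one]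
  rw [hfact]
  have hdom := norm_toL2S_smul_le F (c₀ := c₀) (fun x => (1 - χt x) * Real.exp (-φ x)) (Real.exp_pos (-R)).le
    (abs_one_sub_mul_exp_neg_le F χt φ hχt hR) (fun x => Real.exp (φ x) • u x)
  have hC0 : 0 ≤ 8 * Real.sqrt (max 2 (16 * c₀ * ((F.L : ℝ) ^ (K - n)) ^ 3 / (a * c₁))) ^ 2 := by positivity
  calc _ ≤ Real.exp (-R) * ‖toL2S F K c₀ (fun x => Real.exp (φ x) • u x)‖ := hdom
    _ ≤ Real.exp (-R) * (8 * Real.sqrt (max 2 (16 * c₀ * ((F.L : ℝ) ^ (K - n)) ^ 3 / (a * c₁))) ^ 2 * (8 * Real.sqrt (max 2 (16 * c₀ * ((F.L : ℝ) ^ (K - n)) ^ 3 / (a * c₁))) ^ 2 * ‖toL2S F K c₀ w‖)) :=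
        mul_le_mul_of_nonneg_left (hAL2u.trans (mul_le_mul_of_nonneg_left hAL2v hC0)) (Real.exp_pos _).le
    _ = _ := by ring

end Summit.QuantumFields.YangMills.Theorems.Prop7MassivePropagatorTail
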